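import Mathlib.Analysis.Distribution.SchwartzSpace.Fourier
import Mathlib.Analysis.Fourier.Inversion
import Mathlib.Analysis.Calculus.BumpFunction.InnerProduct
import Mathlib.MeasureTheory.Measure.Haar.InnerProductSpace
import Literature.NumberTheory.LFunctions.RHConditionalFacts
import Literature.NumberTheory.LFunctions.RudnickSarnak
import Literature.NumberTheory.LFunctions.RudnickSarnakLocal
import Literature.NumberTheory.LFunctions.RudnickSarnakZeros
import HarnessLib

/-!
# Rudnick–Sarnak's Theorem 1.2 for `ζ`: from the `T`-indexed form to the printed form (proved)

Proofs only (no definitions, no named facts). Companion of `RudnickSarnak.lean` (the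
decomposition of the discharge of `Literature.NumberTheory.LFunctions.rudnick_sarnak`,
`RHConditionalFacts.lean`, **rh.S32**; Z. Rudnick, P. Sarnak, *Zeros of principal `L`-functions
and random matrix theory*, Duke Math. J. **81** (1996), 269–322, Theorem 1.2 for `m = 1`).

`RudnickSarnak.lean` reduces `rudnick_sarnak` to the named facts `rudnick_sarnak_unrestricted`
(RS Thm. 3.2) and `rudnick_sarnak_sieving` (RS §4 with Thm. 4.1), whose joint conclusion
`RSRestrictedLimits` is Theorem 1.2 in its `T`-indexed form ((3.1), (4.5): `N = N(T)`,
`B_N = B_{N(T)}`) for the test functions `f_Φ` of (3.6), and announces the remaining step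
"`(RH → RSRestrictedLimits) → rudnick_sarnak`" as a theorem of this file. That step has two parts:

1. **Heights to all `N`** (proved here, `IsRSTestFunction.tendsto_levelCorrelationSum_div`): if
   `R_n(f, T) = levelCorrelationSum n f N(T) / N(T) → L` as `T → ∞` then
   `R_n(B_N, f) = levelCorrelationSum n f N / N → L` along all `N → ∞`. RS leave this implicit;
   it is not vacuous, because when `N(T)` jumps by more than one at a height (a multiple zero, or
   distinct zeros with a common ordinate — not excluded by RH) the sets `B_N`,
   `N(T−) < N < N(T)`, are not of the form `B_{N(T)}`. Proof: with `T = γ_N`, `N' = N(γ_N)`: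
   `N < N'`, `N' − N ≤ N(T + 4) − N(T − 1) ≪ log T` and `T ≤ N'` (Riemann–von Mangoldt,
   `RudnickSarnakZeros`); the Schwartz decay of `f` (pivot bound) and the local density
   `≪ log T` of the `γ̃` in windows of length one give
   `‖R_n(B_N, f) − R_n(B_{N'}, f)‖ ≪ (N' − N)(log T)ⁿ/N' ≪ (log T)^{n+1}/T → 0`
   (`RudnickSarnakLocal`, `RudnickSarnak.exists_norm_sub_le`), while `γ_N → ∞`.
2. **Representation** `f = f_Φ` of every Rudnick–Sarnak test function with restricted Fourier
   support by an admissible `Φ` (proved here, `RudnickSarnak.exists_rsPhiTest_eq`): with `g` the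
   Schwartz slice (TF 3) and `Ψ = ĝ` its Fourier transform (`rsSliceFourier f`, transported to
   Mathlib's `𝓕` on `EuclideanSpace ℝ (Fin k)` by `RudnickSarnak.fourier_euclidean_toLp`), take
   `Φ(ξ) = ρ(∑_j ξ_j) Ψ(−ξ_1, …, −ξ_k)` with `ρ` a smooth bump, `ρ = 1` near `0`, supported in
   `|t| < δ/2`; then `Φ` is smooth, vanishes on `∑ |ξ_j| ≥ 2 − δ/2` (`HasRSFourierSupport`
   gives `Ψ = 0` on `|∑ η| + ∑ |η_i| ≥ 2 − δ`), on the hyperplane `Φ(−∑η, η) = Ψ(−η)`, and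
   `f_Φ(x) = ∫ Ψ(−η) e(−y·η) dη = 𝓕⁻ 𝓕 g (y) = g(y) = f(x)` (`y_i = x_i − x_0`; Fourier
   inversion `Continuous.fourierInv_fourier_eq` and TF 1). In `rudnick_sarnak_of_restrictedLimits`
   the representation enters as an explicit hypothesis `hrepr` (first instalment); the
   hypothesis-free forms are `rudnick_sarnak_of_restrictedLimits'` and `rudnick_sarnak_of_sieving`.

## Main results

* `RudnickSarnak.exists_norm_sub_le`: the estimate of part 1.
* `IsRSTestFunction.tendsto_levelCorrelationSum_div`: part 1.
* `rudnick_sarnak_of_restrictedLimits`: `hrepr → (RH → RSRestrictedLimits) → rudnick_sarnak`.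
* `rudnick_sarnak_of_sieving_of_repr`:
  `hrepr → rudnick_sarnak_unrestricted → rudnick_sarnak_sieving → rudnick_sarnak`.
* `RudnickSarnak.exists_rsPhiTest_eq_of_slice` (TF 1 + TF 3 + support suffice; no symmetry),
  `RudnickSarnak.exists_rsPhiTest_eq`: part 2.
* `rudnick_sarnak_of_restrictedLimits'`: `(RH → RSRestrictedLimits) → rudnick_sarnak`.
* `rudnick_sarnak_of_sieving`: `rudnick_sarnak_unrestricted → rudnick_sarnak_sieving → rudnick_sarnak`
  — so the trust base of `rudnick_sarnak` is exactly the two named facts of `RudnickSarnak.lean`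
  (RS Thm. 3.2; RS §4 with Thm. 4.1).

## References

* Z. Rudnick, P. Sarnak, Duke Math. J. 81 (1996): Thm. 1.2 (p. 273), (1.3), (3.1), (3.6), §4
  (4.5), (4.15)–(4.16), Thm. 4.1 (p. 307).
* E. C. Titchmarsh, *The Theory of the Riemann Zeta-Function* (1986), Thms. 9.2, 9.4.
-/

noncomputable section

open Filter Topology Finset MeasureTheory Complex SchwartzMap
open scoped FourierTransform RealInnerProductSpace Real ContDiff

namespace Literature.NumberTheory.LFunctions

namespace RudnickSarnak

/-! ## The estimate `R_n(B_N, f) − R_n(B_{N(γ_N)}, f) → 0` -/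

/-- For naturals `1 ≤ N ≤ N'`: `‖N⁻¹ − N'⁻¹‖ = (N' − N)/(N N')` in `ℂ`. [folklore] -/
theorem norm_inv_natCast_sub_inv_natCast {N N' : ℕ} (hN : 1 ≤ N) (hNN' : N ≤ N') :
    ‖((N : ℂ)⁻¹ - (N' : ℂ)⁻¹)‖ = ((N' : ℝ) - N) / (N * N') := by
  have hN0 : (0 : ℝ) < N := by exact_mod_cast hN
  have hN'0 : (0 : ℝ) < N' := by exact_mod_cast hN.trans hNN'
  have hcast : ((N : ℂ)⁻¹ - (N' : ℂ)⁻¹) = (((N : ℝ)⁻¹ - (N' : ℝ)⁻¹ : ℝ) : ℂ) := by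
    push_cast
    rfl
  rw [hcast, Complex.norm_real, Real.norm_of_nonneg]
  · field_simp
  · rw [sub_nonneg]
    exact inv_anti₀ hN0 (by exact_mod_cast hNN')

/-- **Main estimate.** For a Rudnick–Sarnak test function `f` at level `n = k + 1` there are
`K` and `T₂` such that for every `N ≥ 1` with `γ_N ≥ T₂`, writing `T = γ_N`, `N' = N(T)` and
`S(M) = levelCorrelationSum (k+1) f M`:
`‖S(N)/N − S(N')/N'‖ ≤ K (log T)^{k+2} / T`. Ingredients: `N < N'`, `N' − N ≤ C₁ log T`,
`T ≤ N'` (Riemann–von Mangoldt), the pivot bound for `f`, and the local density of the `γ̃`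
(`RudnickSarnakLocal`, `RudnickSarnakZeros`). [cite: RudnickSarnak1996, §1 (1.3), Thm 1.2] -/
theorem exists_norm_sub_le {k : ℕ} {f : (Fin (k + 1) → ℝ) → ℂ} (hf : IsRSTestFunction k f) :
    ∃ K T₂ : ℝ, ∀ N : ℕ, 1 ≤ N → T₂ ≤ zetaOrdinate N →
      ‖levelCorrelationSum (k + 1) f N / N -
          levelCorrelationSum (k + 1) f (zetaZeroCount (zetaOrdinate N)) /
            zetaZeroCount (zetaOrdinate N)‖ ≤
        K * Real.log (zetaOrdinate N) ^ (k + 2) / zetaOrdinate N := by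
  classical
  obtain ⟨C, hC0, hpiv⟩ := hf.exists_norm_le_prod
  obtain ⟨C₁, hC₁, T₁, hwin⟩ := exists_zetaZeroCount_window_le
  obtain ⟨T₃, hT₃⟩ := eventually_atTop.1 riemann_von_mangoldt_holds.eventually_self_le
  refine ⟨(k + 2) * C * C₁ * (6 * C₁ + 1) ^ (k + 1), max (max T₁ 4) T₃, fun N hN1 hN ↦ ?_⟩
  -- notation
  set T := zetaOrdinate N with hT
  set N' := zetaZeroCount T with hN'
  set S : ℕ → ℂ := fun M ↦ levelCorrelationSum (k + 1) f M with hS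
  have hT₁ : T₁ ≤ T := le_trans (le_trans (le_max_left _ _) (le_max_left _ _)) hN
  have hT4 : 4 ≤ T := le_trans (le_trans (le_max_right _ _) (le_max_left _ _)) hN
  have hT₃T : T₃ ≤ T := le_trans (le_max_right _ _) hN
  have hTpos : 0 < T := by linarith
  have hlogT : 1 ≤ Real.log T := one_le_log_of_four_le hT4
  -- the four inputs
  have hNN' : N < N' := lt_zetaZeroCount_zetaOrdinate N
  have hwinT := hwin T hT₁
  have hjump : (N' : ℝ) - N ≤ C₁ * Real.log T := zetaZeroCount_zetaOrdinate_sub_le hwinT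
  have hTN' : T ≤ (N' : ℝ) := hT₃ T hT₃T
  set s : ℝ := (6 * C₁ + 1) * Real.log T with hs
  have hs1 : 1 ≤ s := by
    rw [hs]
    nlinarith
  have hloc : ∀ b < N', ∑ c ∈ Finset.range N',
      ((1 + |normalizedOrdinate c - normalizedOrdinate b|) ^ 2)⁻¹ ≤ s := by
    intro b _
    have h := sum_inv_one_add_abs_sub_sq_le (Finset.range N') normalizedOrdinate
      (card_filter_normalizedOrdinate_window_le hTpos.le hwinT) (normalizedOrdinate b)
    refine h.trans ?_
    rw [hs]
    nlinarith
  -- the two tuple-sum estimates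
  have hSN : S N = ∑ u ∈ (Fintype.piFinset fun _ : Fin (k + 1) ↦ Finset.range N) with
      Function.Injective u, f (fun a ↦ normalizedOrdinate (u a)) :=
    levelCorrelationSum_eq_sum_filter (k + 1) f N
  have hSN' : S N' = ∑ u ∈ (Fintype.piFinset fun _ : Fin (k + 1) ↦ Finset.range N') with
      Function.Injective u, f (fun a ↦ normalizedOrdinate (u a)) :=
    levelCorrelationSum_eq_sum_filter (k + 1) f N'
  have hA : ‖S N' - S N‖ ≤ (k + 1 : ℕ) * (C * ((N' : ℝ) - N) * s ^ (k + 1)) := by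
    rw [hSN, hSN']
    exact norm_tupleSum_sdiff_le f normalizedOrdinate hC0 hs1 hpiv hNN'.le hloc
  have hlocN : ∀ b < N, ∑ c ∈ Finset.range N,
      ((1 + |normalizedOrdinate c - normalizedOrdinate b|) ^ 2)⁻¹ ≤ s := by
    intro b hb
    refine le_trans ?_ (hloc b (hb.trans hNN'))
    exact Finset.sum_le_sum_of_subset_of_nonneg (Finset.range_mono hNN'.le)
      fun c _ _ ↦ by positivity
  have hB : ‖S N‖ ≤ C * N * s ^ (k + 1) := by
    rw [hSN]
    exact norm_tupleSum_le f normalizedOrdinate hC0 hs1 hpiv hlocN 0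
  -- algebra
  have hNpos : (0 : ℝ) < N := by exact_mod_cast hN1
  have hN'pos : (0 : ℝ) < N' := by exact_mod_cast hN1.trans hNN'.le
  have hident : S N / N - S N' / N' =
      (S N - S N') * (N' : ℂ)⁻¹ + S N * ((N : ℂ)⁻¹ - (N' : ℂ)⁻¹) := by
    ring
  have hnormN' : ‖(N' : ℂ)⁻¹‖ = (N' : ℝ)⁻¹ := by
    rw [norm_inv, Complex.norm_natCast]
  have hjump0 : 0 ≤ (N' : ℝ) - N := by
    have : (N : ℝ) ≤ N' := by exact_mod_cast hNN'.le
    linarith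
  have hspow : 0 ≤ s ^ (k + 1) := by positivity
  calc ‖S N / N - S N' / N'‖
      = ‖(S N - S N') * (N' : ℂ)⁻¹ + S N * ((N : ℂ)⁻¹ - (N' : ℂ)⁻¹)‖ := by rw [hident]
    _ ≤ ‖S N - S N'‖ * ‖(N' : ℂ)⁻¹‖ + ‖S N‖ * ‖((N : ℂ)⁻¹ - (N' : ℂ)⁻¹)‖ := by
        refine (norm_add_le _ _).trans ?_
        rw [norm_mul, norm_mul]
    _ = ‖S N' - S N‖ * (N' : ℝ)⁻¹ + ‖S N‖ * (((N' : ℝ) - N) / (N * N')) := by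
        rw [hnormN', norm_inv_natCast_sub_inv_natCast hN1 hNN'.le, norm_sub_rev]
    _ ≤ (k + 1 : ℕ) * (C * ((N' : ℝ) - N) * s ^ (k + 1)) * (N' : ℝ)⁻¹ +
          C * N * s ^ (k + 1) * (((N' : ℝ) - N) / (N * N')) := by
        gcongr
    _ = ((k : ℝ) + 2) * C * s ^ (k + 1) * (((N' : ℝ) - N) / N') := by
        field_simp
        push_cast
        ring
    _ ≤ ((k : ℝ) + 2) * C * s ^ (k + 1) * (C₁ * Real.log T / T) := by
        gcongr ((k : ℝ) + 2) * C * s ^ (k + 1) * ?_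
        calc ((N' : ℝ) - N) / N' ≤ ((N' : ℝ) - N) / T :=
              div_le_div_of_nonneg_left hjump0 hTpos hTN'
          _ ≤ C₁ * Real.log T / T := div_le_div_of_nonneg_right hjump hTpos.le
    _ = (k + 2) * C * C₁ * (6 * C₁ + 1) ^ (k + 1) * Real.log T ^ (k + 2) / T := by
        rw [hs, mul_pow]
        ring

end RudnickSarnak

/-! ## From heights to all `N` -/

open RudnickSarnak in
/-- **Heights to all `N`.** For a Rudnick–Sarnak test function `f` at level `n = k + 1`: if the
`T`-indexed correlation function `R_n(f, T) = levelCorrelationSum n f N(T) / N(T)` (RS (3.1),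
`N = N(T)`, `B_N = B_{N(T)}` (4.5)) tends to `L` as `T → ∞`, then
`R_n(B_N, f) = levelCorrelationSum n f N / N → L` along all `N → ∞` (the form printed in
Theorem 1.2): `R_n(B_N, f) = R_n(B_{N(γ_N)}, f) + O((log γ_N)^{n+1}/γ_N)`
(`RudnickSarnak.exists_norm_sub_le`) and `γ_N → ∞` (`tendsto_zetaOrdinate_atTop`).
[cite: RudnickSarnak1996, Thm 1.2 with (3.1), (4.5)] -/
theorem IsRSTestFunction.tendsto_levelCorrelationSum_div {k : ℕ} {f : (Fin (k + 1) → ℝ) → ℂ}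
    (hf : IsRSTestFunction k f) {L : ℂ}
    (hlim : Tendsto (fun T : ℝ ↦ levelCorrelationSum (k + 1) f (zetaZeroCount T) /
      zetaZeroCount T) atTop (𝓝 L)) :
    Tendsto (fun N : ℕ ↦ levelCorrelationSum (k + 1) f N / N) atTop (𝓝 L) := by
  -- along `N' = N(γ_N)`
  have h1 : Tendsto (fun N : ℕ ↦ levelCorrelationSum (k + 1) f (zetaZeroCount (zetaOrdinate N)) /
      zetaZeroCount (zetaOrdinate N)) atTop (𝓝 L) :=
    hlim.comp tendsto_zetaOrdinate_atTop
  -- the difference tends to `0`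
  obtain ⟨K, T₂, hK⟩ := exists_norm_sub_le hf
  have hbound : Tendsto (fun N : ℕ ↦ K * Real.log (zetaOrdinate N) ^ (k + 2) / zetaOrdinate N)
      atTop (𝓝 0) := by
    have h0 := (Real.tendsto_pow_log_div_mul_add_atTop 1 0 (k + 2) one_ne_zero).comp
      tendsto_zetaOrdinate_atTop
    have h0' : Tendsto (fun N : ℕ ↦ K * (Real.log (zetaOrdinate N) ^ (k + 2) /
        (1 * zetaOrdinate N + 0))) atTop (𝓝 (K * 0)) := h0.const_mul K
    rw [mul_zero] at h0'
    refine h0'.congr fun N ↦ ?_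
    simp only [one_mul, add_zero]
    ring
  have h2 : Tendsto (fun N : ℕ ↦ levelCorrelationSum (k + 1) f N / N -
      levelCorrelationSum (k + 1) f (zetaZeroCount (zetaOrdinate N)) /
        zetaZeroCount (zetaOrdinate N)) atTop (𝓝 0) := by
    refine squeeze_zero_norm' ?_ hbound
    filter_upwards [eventually_ge_atTop 1, tendsto_zetaOrdinate_atTop.eventually_ge_atTop T₂]
      with N hN1 hN2 using hK N hN1 hN2
  have h3 := h1.add h2
  rw [add_zero] at h3
  refine h3.congr fun N ↦ ?_
  ring

/-! ## Assembly, modulo the representation `f = f_Φ` -/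

/-- **Theorem 1.2 for `ζ` from its `T`-indexed form.** If every Rudnick–Sarnak test function
with restricted Fourier support is an `f_Φ` ((3.6), `rsPhiTest Φ`) with `Φ` admissible
(hypothesis `hrepr`; Fourier inversion on the Schwartz slice), then the `T`-indexed Theorem 1.2
for the `f_Φ` under RH (`RSRestrictedLimits`, the conclusion of RS §4) implies the printed
Theorem 1.2 (`rudnick_sarnak`), by `IsRSTestFunction.tendsto_levelCorrelationSum_div`.
[cite: RudnickSarnak1996, Thm 1.2] -/
theorem rudnick_sarnak_of_restrictedLimits
    (hrepr : ∀ {k : ℕ} {f : (Fin (k + 1) → ℝ) → ℂ}, 1 ≤ k → IsRSTestFunction k f →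
      HasRSFourierSupport k f → ∃ Φ : (Fin (k + 1) → ℝ) → ℂ, IsRSAdmissiblePhi k Φ ∧ rsPhiTest Φ = f)
    (h : RiemannHypothesis → RSRestrictedLimits) : rudnick_sarnak := by
  intro hRH k hk f hf hsupp
  obtain ⟨Φ, hΦ, rfl⟩ := hrepr hk hf hsupp
  exact hf.tendsto_levelCorrelationSum_div (h hRH hk hΦ hf)

/-- The same from the two named facts of `RudnickSarnak.lean`: RS Thm. 3.2
(`rudnick_sarnak_unrestricted`) and RS §4/Thm. 4.1 (`rudnick_sarnak_sieving`), modulo the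
representation hypothesis `hrepr`. [cite: RudnickSarnak1996, Thm 1.2, Thm 3.2, §4] -/
theorem rudnick_sarnak_of_sieving_of_repr
    (hrepr : ∀ {k : ℕ} {f : (Fin (k + 1) → ℝ) → ℂ}, 1 ≤ k → IsRSTestFunction k f →
      HasRSFourierSupport k f → ∃ Φ : (Fin (k + 1) → ℝ) → ℂ, IsRSAdmissiblePhi k Φ ∧ rsPhiTest Φ = f)
    (h₁ : rudnick_sarnak_unrestricted) (h₂ : rudnick_sarnak_sieving) : rudnick_sarnak :=
  rudnick_sarnak_of_restrictedLimits hrepr fun hRH ↦ h₂ hRH (h₁ hRH)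

/-! ## The representation `f = f_Φ` (Fourier inversion on the Schwartz slice) -/

namespace RudnickSarnak

/-- Transport of Mathlib's Fourier transform on `EuclideanSpace ℝ (Fin k)` to the explicit
integral on `Fin k → ℝ`: `𝓕 (F ∘ ofLp) (toLp w) = ∫ F(η) e^{-2πi η·w} dη`. [folklore] -/
theorem fourier_euclidean_toLp {k : ℕ} (F : (Fin k → ℝ) → ℂ) (w : Fin k → ℝ) :
    𝓕 (fun v : EuclideanSpace ℝ (Fin k) ↦ F (WithLp.ofLp v)) (WithLp.toLp 2 w) =
      ∫ η : Fin k → ℝ, F η * Complex.exp (-(2 * π * I * ∑ i, (η i * w i : ℝ))) := by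
  rw [Real.fourier_eq']
  rw [← (PiLp.volume_preserving_toLp (Fin k)).integral_comp
    (MeasurableEquiv.toLp 2 (Fin k → ℝ)).measurableEmbedding]
  congr 1
  funext η
  simp only [smul_eq_mul]
  rw [mul_comm]
  congr 1
  have hinner : ⟪WithLp.toLp 2 η, WithLp.toLp 2 w⟫ = ∑ i, η i * w i := by
    rw [EuclideanSpace.inner_toLp_toLp]
    simp [dotProduct, mul_comm]
  rw [hinner]
  push_cast
  ring_nf

/-- **Representation of test functions, without symmetry.** Every diagonal-invariant `f` on
`ℝ^{k+1}` (TF 1) whose slice `y ↦ f(0, y)` is a Schwartz function (TF 3) and whose Fourier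
transform along the hyperplane is supported in `∑ |ξ_j| < 2` (`HasRSFourierSupport`) is an
`f_Φ` (RS (3.6), `rsPhiTest Φ`) for an admissible `Φ` (`IsRSAdmissiblePhi`); symmetry (TF 2) is
not needed (RS p. 284 work with `f` "satisfying TF 2, 3", i.e. without symmetry, "to carry out
the induction in Section 4"). Construction: `Φ(ξ) = ρ(∑_j ξ_j) Ψ(−ξ_1, …, −ξ_k)` with `Ψ` the
Fourier transform of the Schwartz slice and `ρ` a smooth bump equal to `1` near `0`; on the
hyperplane `Φ(−∑η, η) = Ψ(−η)`, and `f_Φ = f` is Fourier inversion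
(`Continuous.fourierInv_fourier_eq`) plus TF 1. [cite: RudnickSarnak1996, (3.6)] -/
theorem exists_rsPhiTest_eq_of_slice {k : ℕ} {f : (Fin (k + 1) → ℝ) → ℂ}
    (hdiag : ∀ (x : Fin (k + 1) → ℝ) (t : ℝ), f (fun i ↦ x i + t) = f x)
    (hslice : ∃ g : SchwartzMap (Fin k → ℝ) ℂ, ⇑g = rsSlice f)
    (hsupp : HasRSFourierSupport k f) :
    ∃ Φ : (Fin (k + 1) → ℝ) → ℂ, IsRSAdmissiblePhi k Φ ∧ rsPhiTest Φ = f := by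
  obtain ⟨g, hg⟩ := hslice
  obtain ⟨δ, hδ, hΨ⟩ := hsupp
  -- transport `g` to Euclidean space, where Mathlib's Fourier analysis lives
  set e : EuclideanSpace ℝ (Fin k) ≃L[ℝ] (Fin k → ℝ) :=
    PiLp.continuousLinearEquiv 2 ℝ (fun _ : Fin k ↦ ℝ) with he
  set G : 𝓢(EuclideanSpace ℝ (Fin k), ℂ) := SchwartzMap.compCLMOfContinuousLinearEquiv ℂ e g
    with hG
  have hGcoe : (⇑G : EuclideanSpace ℝ (Fin k) → ℂ) = fun v ↦ g (WithLp.ofLp v) := rfl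
  -- the Fourier transform of the slice, read on `Fin k → ℝ`
  set Ψ : (Fin k → ℝ) → ℂ := fun η ↦ (𝓕 G) (WithLp.toLp 2 η) with hΨdef
  have hΨ_eq : ∀ η, Ψ η = rsSliceFourier f η := by
    intro η
    simp only [hΨdef, SchwartzMap.fourier_coe, hGcoe, fourier_euclidean_toLp]
    simp only [rsSliceFourier, ← hg]
  -- the bump and the candidate
  set ρ : ContDiffBump (0 : ℝ) := ⟨δ / 4, δ / 2, by positivity, by linarith⟩ with hρ
  set Φ : (Fin (k + 1) → ℝ) → ℂ := fun ξ ↦ ((ρ (∑ j, ξ j) : ℝ) : ℂ) * Ψ (fun i ↦ -ξ i.succ)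
    with hΦ
  refine ⟨Φ, ⟨?_, ?_⟩, ?_⟩
  · -- smoothness
    have h1 : ContDiff ℝ ∞ (fun ξ : Fin (k + 1) → ℝ ↦ ((ρ (∑ j, ξ j) : ℝ) : ℂ)) := by
      have hsum : ContDiff ℝ ∞ (fun ξ : Fin (k + 1) → ℝ ↦ ∑ j, ξ j) :=
        ContDiff.sum fun j _ ↦ contDiff_apply ℝ ℝ j
      exact Complex.ofRealCLM.contDiff.comp (ρ.contDiff.comp hsum)
    have h2 : ContDiff ℝ ∞ (fun ξ : Fin (k + 1) → ℝ ↦ Ψ (fun i ↦ -ξ i.succ)) := by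
      have hlin : ContDiff ℝ ∞ (fun ξ : Fin (k + 1) → ℝ ↦ (fun i : Fin k ↦ -ξ i.succ)) :=
        contDiff_pi.2 fun i : Fin k ↦ (contDiff_apply ℝ ℝ i.succ).neg
      have htoLp : ContDiff ℝ ∞
          (fun η : Fin k → ℝ ↦ (WithLp.toLp 2 η : EuclideanSpace ℝ (Fin k))) :=
        e.symm.contDiff
      exact ((𝓕 G).smooth ⊤).comp (htoLp.comp hlin)
    exact h1.mul h2
  · -- support inside `∑ |ξ_j| < 2`
    refine ⟨δ / 2, by positivity, fun ξ hξ ↦ ?_⟩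
    by_cases hA : δ / 2 ≤ |∑ j, ξ j|
    · have h0 : ρ (∑ j, ξ j) = 0 :=
        ρ.zero_of_le_dist (by simpa [Real.dist_eq] using hA)
      simp [hΦ, h0]
    · have hB : |∑ j, ξ j| < δ / 2 := not_le.1 hA
      have hzero : Ψ (fun i ↦ -ξ i.succ) = 0 := by
        rw [hΨ_eq]
        apply hΨ
        have hsplit : ∑ j, |ξ j| = |ξ 0| + ∑ i : Fin k, |ξ i.succ| := Fin.sum_univ_succ _
        have hsplit' : ∑ j, ξ j = ξ 0 + ∑ i : Fin k, ξ i.succ := Fin.sum_univ_succ _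
        have h0 : |ξ 0| ≤ |∑ j, ξ j| + |∑ i : Fin k, -ξ i.succ| := by
          rw [Finset.sum_neg_distrib, abs_neg]
          calc |ξ 0| = |(∑ j, ξ j) - ∑ i : Fin k, ξ i.succ| := by
                rw [hsplit', add_sub_cancel_right]
            _ ≤ |∑ j, ξ j| + |∑ i : Fin k, ξ i.succ| := abs_sub _ _
        have habs : ∑ i : Fin k, |-ξ i.succ| = ∑ i : Fin k, |ξ i.succ| := by simp [abs_neg]
        rw [habs]
        linarith
      simp [hΦ, hzero]
  · -- the identity `f_Φ = f`
    funext x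
    set y : Fin k → ℝ := fun i ↦ x i.succ - x 0 with hy
    have hfx : f x = g y := by
      have h1 : f x = f (fun a ↦ x a + -x 0) := (hdiag x (-x 0)).symm
      have h2 : (fun a ↦ x a + -x 0) = Fin.cons 0 y := by
        funext a
        refine Fin.cases ?_ (fun l ↦ ?_) a
        · simp
        · simp [hy, sub_eq_add_neg]
      rw [h1, h2, show f (Fin.cons 0 y) = rsSlice f y from rfl, ← hg]
    -- on the hyperplane `Φ(-∑η, η) = Ψ(-η)`
    have hstep1 : rsPhiTest Φ x = ∫ η : Fin k → ℝ,
        Ψ (fun i ↦ -η i) * Complex.exp (-(2 * π * I * ∑ i, (η i * y i : ℝ))) := by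
      unfold rsPhiTest
      congr 1
      funext η
      have hρ1 : ρ (∑ j, (Fin.cons (-∑ i, η i) η : Fin (k + 1) → ℝ) j) = 1 := by
        rw [Fin.sum_cons, neg_add_cancel]
        exact ρ.one_of_mem_closedBall (Metric.mem_closedBall_self ρ.rIn_pos.le)
      simp only [hΦ, Fin.cons_succ, hρ1, Complex.ofReal_one, one_mul, hy]
      congr 2
      simp only [mul_comm]
    -- the integral is a Fourier transform on Euclidean space
    set FG : EuclideanSpace ℝ (Fin k) → ℂ := 𝓕 (⇑G) with hFG
    have hstep2 : (∫ η : Fin k → ℝ,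
        Ψ (fun i ↦ -η i) * Complex.exp (-(2 * π * I * ∑ i, (η i * y i : ℝ)))) =
          (𝓕 (fun v : EuclideanSpace ℝ (Fin k) ↦ FG (-v)) : EuclideanSpace ℝ (Fin k) → ℂ)
            (WithLp.toLp 2 y) := by
      rw [← fourier_euclidean_toLp (fun η ↦ Ψ (fun i ↦ -η i)) y]
      congr 1
    -- Fourier inversion
    have hstep3 : (𝓕 (fun v : EuclideanSpace ℝ (Fin k) ↦ FG (-v)) : EuclideanSpace ℝ (Fin k) → ℂ)
        (WithLp.toLp 2 y) = g y := by
      have hint : Integrable FG := by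
        have := (𝓕 G).integrable (μ := volume)
        rwa [SchwartzMap.fourier_coe] at this
      rw [hFG, ← Real.fourierInv_eq_fourier_comp_neg,
        G.continuous.fourierInv_fourier_eq G.integrable hint]
      rfl
    rw [hstep1, hstep2, hstep3, hfx]

/-- **Representation of Rudnick–Sarnak test functions.** Every `f` satisfying TF 1–3
(`IsRSTestFunction`) whose Fourier transform along the hyperplane is supported in
`∑ |ξ_j| < 2` (`HasRSFourierSupport`) is an `f_Φ` (RS (3.6), `rsPhiTest Φ`) for an admissible
`Φ` (`IsRSAdmissiblePhi`) — `exists_rsPhiTest_eq_of_slice` with TF 1 and TF 3.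
[cite: RudnickSarnak1996, (3.6)] -/
theorem exists_rsPhiTest_eq {k : ℕ} {f : (Fin (k + 1) → ℝ) → ℂ} (hf : IsRSTestFunction k f)
    (hsupp : HasRSFourierSupport k f) :
    ∃ Φ : (Fin (k + 1) → ℝ) → ℂ, IsRSAdmissiblePhi k Φ ∧ rsPhiTest Φ = f :=
  exists_rsPhiTest_eq_of_slice hf.diag_invariant hf.schwartz_slice hsupp

end RudnickSarnak

/-! ## Assembly -/

/-- **Theorem 1.2 for `ζ` from its `T`-indexed form**, hypothesis-free version of
`rudnick_sarnak_of_restrictedLimits`: the representation `f = f_Φ` is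
`RudnickSarnak.exists_rsPhiTest_eq`. [cite: RudnickSarnak1996, Thm 1.2] -/
theorem rudnick_sarnak_of_restrictedLimits' (h : RiemannHypothesis → RSRestrictedLimits) :
    rudnick_sarnak :=
  rudnick_sarnak_of_restrictedLimits
    (fun _ hf hsupp ↦ RudnickSarnak.exists_rsPhiTest_eq hf hsupp) h

/-- **Rudnick–Sarnak, Theorem 1.2 for `ζ`, from RS Thm. 3.2 and RS §4/Thm. 4.1.** The named fact
`rudnick_sarnak` (`RHConditionalFacts.lean`) follows from the two named facts of
`RudnickSarnak.lean`: `rudnick_sarnak_unrestricted` (RS Theorem 3.2 for `m = 1`: limits of the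
unrestricted sums `C_n(f_Φ, T)/N(T)`) and `rudnick_sarnak_sieving` (RS §4: Möbius sieving
(4.9), (4.15)–(4.16), and Theorem 4.1 `Ŵ_n = R_O`), via the representation of test functions
as `f_Φ` and the passage from heights to all `N` (both proved in this file). Discharging those
two facts discharges `rudnick_sarnak`. [cite: RudnickSarnak1996, Thm 1.2, Thm 3.2, §4 Thm 4.1] -/
theorem rudnick_sarnak_of_sieving (h₁ : rudnick_sarnak_unrestricted) (h₂ : rudnick_sarnak_sieving) :
    rudnick_sarnak :=
  rudnick_sarnak_of_restrictedLimits' fun hRH ↦ h₂ hRH (h₁ hRH)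

end Literature.NumberTheory.LFunctions

end
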